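import Summits.AtomisticToContinuum.HydrodynamicLimit.Cruxes.InfluenceLocality.Disproof

/-!
# crux-plan `jensen-static-pressures` for `InfluenceLocality` (stmt-AtomisticToContinuum-13916):
# why there is NO concluding skeleton along this idea — kernel-checked part

planner-cruxplan-stmt-AtomisticToContinuum-13916-jensen-static-pressu-0 · 2026-08-16.
Sorry-free. Imports the standing `Disproof.lean` (cdisprove cycle 1 v4) for `Bound`, `badCount`,
`gibbs`, `Flow`, `ClusterFlows`, `ell`, `influenceLocality_iff`.

## What is checked here

1. `badCount_mono_T`, `bound_anti`: the crux's inner inequality `Bound a θ u₀ σ T lam δ R N Φ Ψ`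
   is ANTITONE in the horizon `T` and in the rate `lam` (more time ⇒ more bad particles;
   `exp` is monotone).
2. `RegimeLocality S`: the crux with its `∀ T lam` restricted to a regime `S T lam`.
   `influenceLocality_iff_regime_univ` (`Iff.rfl`-level), `regimeLocality_mono`, and the
   COFINALITY TRANSFER `regimeLocality_of_cofinal`: if every point of `S` is dominated
   (coordinatewise) by a point of `S'`, the crux on `S'` gives the crux on `S`.
3. The idea's deliverable. Card `jensen-static-pressures` (rev. 2, B6) prices the FAST half of
   the bad count "for every `lam ≤ lam_F(T) := ε/(224 ρ M θ^{3/2} T³)`", i.e. on the regime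
   `StaticRegime c := {lam · T³ ≤ c}` (the logarithmic factor `M(T)` only shrinks it), and
   DISOWNS the complement `BlastRegime c := {c < lam · T³}` (B1: "everything above it is
   Sedov"; dead line (g)). `blast_cofinal`: the complement is cofinal. Hence
   `influenceLocality_iff_blastRegime : InfluenceLocality ↔ RegimeLocality (BlastRegime c)` for
   EVERY real `c`, and `staticRegime_of_blastRegime`: the crux restricted to the idea's regime is
   a COROLLARY of the crux restricted to the regime the idea disowns.

CONSEQUENCE (the no-skeleton verdict, see `Lines/jensen-static-pressures.md`): in any stub set
`stub₁ → … → stub_k → InfluenceLocality`, the stubs must already prove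
`RegimeLocality (BlastRegime c)`; that statement alone implies both the crux and everything the
idea's static pricing delivers, so a stub carrying the idea's pricing is logically idle (shred),
while the blast-regime stub is exactly the LD-sublinear-blast-yield / steered-dispersal statement
that the panel failed 3/3 (TRIAGE-r1-1 l.45, r1-2 l.88, r1-3 l.66; r1-3 note A: an `R`-uniform
witness family) and that the card itself hands to `blast-front-energy`.

4. `kineticTimeAbove`, `FastKineticPressure`, `InfluenceLocalityTied`: the TYPED forms of what
   the idea would contribute under a restated crux (statements only, no `sorry`): the level-`u`
   kinetic-time functional of the true flow, its Jensen-in-time product pressure bound under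
   `G_N` (provable from `HomogeneousInvariance` 9621 + Tonelli + the Gaussian integral), and the
   "amplitude tied to the horizon" restatement `RegimeLocality (StaticRegime c)` named in
   IdeatorOneNotes rec. 1 — recorded for the tenure planner, NOT proposed (SteeredDispersal §5 /
   TRIAGE-r1-2 F1: the consumer 13917 needs `lam ≥ 12 κ_amp` at `T(δ) → ∞`, outside every
   `StaticRegime c`). `influenceLocality_iff_tiedInside`: the tie is a weakening only with `c`
   fixed before `σ₀`; with `c` chosen per point it is the crux again.
-/

namespace Summit.AtomisticToContinuum.HydrodynamicLimit.Cruxes.InfluenceLocality.JensenStaticPressures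

open MeasureTheory Set
open scoped ENNReal BigOperators
open Literature.Analysis.FluidPDE Literature.MathematicalPhysics.KineticTheory
open Summit.AtomisticToContinuum.HydrodynamicLimit.Theses.AntiMazurCoboundaries (InfluenceLocality)
open Summit.AtomisticToContinuum.HydrodynamicLimit.Cruxes.InfluenceLocality.Disproof

noncomputable section

/-! ## 1. Monotonicity of `Bound` in the horizon and the rate -/

/-- More time, more bad particles: `#bad` over `[0, Tℓ]` is monotone in `T`. -/
theorem badCount_mono_T {σ T T' R : ℝ} (hT : T ≤ T') (N : ℕ) (Φ : Flow σ N)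
    (Ψ : ClusterFlows σ N) (z : Config (N + 1) (Fin 3) T3) :
    badCount σ T R N Φ Ψ z ≤ badCount σ T' R N Φ Ψ z := by
  unfold badCount
  refine Finset.card_le_card fun i hi => ?_
  simp only [Finset.mem_filter, Finset.mem_univ, true_and] at hi ⊢
  obtain ⟨t, ⟨ht0, htT⟩, hne⟩ := hi
  refine ⟨t, ⟨ht0, htT.trans ?_⟩, hne⟩
  exact mul_le_mul_of_nonneg_right hT (Real.rpow_nonneg (by positivity) _)

/-- `Bound` is antitone in `(T, lam)`: the bound at a larger horizon and a larger rate (same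
`δ`, `R`, `N`, flows) implies the bound at the smaller ones. -/
theorem bound_anti {a θ : ℝ} {u₀ : V3} {σ T T' lam lam' δ R : ℝ} {N : ℕ} {Φ : Flow σ N}
    {Ψ : ClusterFlows σ N} (hlam : 0 ≤ lam) (hl : lam ≤ lam') (hT : T ≤ T')
    (h : Bound a θ u₀ σ T' lam' δ R N Φ Ψ) : Bound a θ u₀ σ T lam δ R N Φ Ψ := by
  unfold Bound at h ⊢
  refine le_trans (lintegral_mono fun z => ENNReal.ofReal_le_ofReal (Real.exp_le_exp.2 ?_)) h
  have h1 : (badCount σ T R N Φ Ψ z : ℝ) ≤ badCount σ T' R N Φ Ψ z := by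
    exact_mod_cast badCount_mono_T hT N Φ Ψ z
  calc lam * (badCount σ T R N Φ Ψ z : ℝ) ≤ lam * badCount σ T' R N Φ Ψ z :=
        mul_le_mul_of_nonneg_left h1 hlam
    _ ≤ lam' * badCount σ T' R N Φ Ψ z :=
        mul_le_mul_of_nonneg_right hl (Nat.cast_nonneg _)

/-! ## 2. The crux restricted to a regime of `(T, lam)`, and the cofinality transfer -/

/-- The crux `InfluenceLocality` with `∀ T lam` restricted to the pairs satisfying `S T lam`
(verbatim quantifier shell of `influenceLocality_iff` otherwise). -/
def RegimeLocality (S : ℝ → ℝ → Prop) : Prop :=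
  ∀ (a θ : ℝ) (u₀ : V3), 0 < a → 0 < θ → ∃ σ₀ : ℝ, 0 < σ₀ ∧ ∀ σ : ℝ, 0 < σ → σ < σ₀ →
    ∀ (T lam δ : ℝ), 0 < T → 0 < lam → 0 < δ → S T lam → ∃ R : ℝ, 0 < R ∧ ∃ N₀ : ℕ,
    ∀ N : ℕ, N₀ ≤ N → ∀ (Φ : Flow σ N) (Ψ : ClusterFlows σ N), Bound a θ u₀ σ T lam δ R N Φ Ψ

/-- The crux is its own restriction to the trivial regime. -/
theorem influenceLocality_iff_regime_univ :
    InfluenceLocality ↔ RegimeLocality fun _ _ => True := by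
  rw [influenceLocality_iff]
  unfold RegimeLocality
  constructor
  · intro h a θ u₀ ha hθ
    obtain ⟨σ₀, hσ₀, hσ⟩ := h a θ u₀ ha hθ
    exact ⟨σ₀, hσ₀, fun σ hs hs' T lam δ hT hlam hδ _ => hσ σ hs hs' T lam δ hT hlam hδ⟩
  · intro h a θ u₀ ha hθ
    obtain ⟨σ₀, hσ₀, hσ⟩ := h a θ u₀ ha hθ
    exact ⟨σ₀, hσ₀, fun σ hs hs' T lam δ hT hlam hδ => hσ σ hs hs' T lam δ hT hlam hδ trivial⟩

/-- Restriction to a smaller regime. -/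
theorem regimeLocality_mono {S S' : ℝ → ℝ → Prop} (hSS' : ∀ T lam, S T lam → S' T lam)
    (h : RegimeLocality S') : RegimeLocality S := by
  intro a θ u₀ ha hθ
  obtain ⟨σ₀, hσ₀, hσ⟩ := h a θ u₀ ha hθ
  exact ⟨σ₀, hσ₀, fun σ hs hs' T lam δ hT hlam hδ hS =>
    hσ σ hs hs' T lam δ hT hlam hδ (hSS' T lam hS)⟩

/-- **COFINALITY TRANSFER.** If every `(T, lam)` of regime `S` (with `T, lam > 0`) is dominated
coordinatewise by some `(T', lam')` of regime `S'`, then the crux on `S'` implies the crux on `S`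
(take the `R, N₀` of the dominating pair; `bound_anti`). -/
theorem regimeLocality_of_cofinal {S S' : ℝ → ℝ → Prop}
    (hcof : ∀ T lam, 0 < T → 0 < lam → S T lam → ∃ T' lam', T ≤ T' ∧ lam ≤ lam' ∧ S' T' lam')
    (h : RegimeLocality S') : RegimeLocality S := by
  intro a θ u₀ ha hθ
  obtain ⟨σ₀, hσ₀, hσ⟩ := h a θ u₀ ha hθ
  refine ⟨σ₀, hσ₀, fun σ hs hs' T lam δ hT hlam hδ hS => ?_⟩
  obtain ⟨T', lam', hTT', hll', hS'⟩ := hcof T lam hT hlam hS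
  obtain ⟨R, hR, N₀, hN⟩ := hσ σ hs hs' T' lam' δ (hT.trans_le hTT') (hlam.trans_le hll') hδ hS'
  exact ⟨R, hR, N₀, fun N hN₀ Φ Ψ => bound_anti hlam.le hll' hTT' (hN N hN₀ Φ Ψ)⟩

/-! ## 3. The idea's regime is subsumed by its complement -/

/-- STATIC REGIME of card `jensen-static-pressures`: `lam · T³ ≤ c`
(`lam ≤ lam_F(T) ≍ ε/(224 ρ M(T) θ^{3/2} T³)`, IdeatorOneNotes B6; we drop the factor `1/M(T)`,
which only makes the regime smaller). -/
def StaticRegime (c : ℝ) : ℝ → ℝ → Prop := fun T lam => lam * T ^ 3 ≤ c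

/-- BLAST REGIME: the complement `c < lam · T³`, disowned by the card (B1, dead line (g)) and
handed to `blast-front-energy` / `SublinearBlastYield` (failed at triage 3/3). -/
def BlastRegime (c : ℝ) : ℝ → ℝ → Prop := fun T lam => c < lam * T ^ 3

/-- Every admissible `(T, lam)` is dominated by a point of the blast regime (raise `lam`). -/
theorem blast_cofinal (c : ℝ) :
    ∀ T lam, 0 < T → 0 < lam → True → ∃ T' lam', T ≤ T' ∧ lam ≤ lam' ∧ BlastRegime c T' lam' := by
  intro T lam hT _ _
  have hT3 : 0 < T ^ 3 := by positivity
  refine ⟨T, max lam ((|c| + 1) / T ^ 3), le_rfl, le_max_left _ _, ?_⟩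
  unfold BlastRegime
  calc c ≤ |c| := le_abs_self c
    _ < |c| + 1 := lt_add_one _
    _ = (|c| + 1) / T ^ 3 * T ^ 3 := by field_simp
    _ ≤ max lam ((|c| + 1) / T ^ 3) * T ^ 3 :=
        mul_le_mul_of_nonneg_right (le_max_right _ _) hT3.le

/-- **The crux is EQUIVALENT to its restriction to the regime the idea disowns** (any `c`). -/
theorem influenceLocality_iff_blastRegime (c : ℝ) :
    InfluenceLocality ↔ RegimeLocality (BlastRegime c) := by
  rw [influenceLocality_iff_regime_univ]
  exact ⟨regimeLocality_mono fun _ _ _ => trivial, regimeLocality_of_cofinal (blast_cofinal c)⟩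

/-- … and the idea's deliverable (the crux on its static regime) is a corollary of that
restriction: a stub carrying it is idle in any concluding skeleton. -/
theorem staticRegime_of_blastRegime (c : ℝ) (h : RegimeLocality (BlastRegime c)) :
    RegimeLocality (StaticRegime c) :=
  regimeLocality_mono (fun _ _ _ => trivial) ((influenceLocality_iff_blastRegime c).2 h |>
    (influenceLocality_iff_regime_univ).1)

/-- The same subsumption phrased with the horizon instead of the rate: the crux is also
equivalent to its restriction to LONG horizons `T₀ < T` (any `T₀`), the regime where the
static-witness ceiling (IdeatorOneNotes B5: `T ≲ 0.03 t_mf`) and the blast plateau bite. -/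
theorem influenceLocality_iff_longHorizon (T₀ : ℝ) :
    InfluenceLocality ↔ RegimeLocality fun T _ => T₀ < T := by
  rw [influenceLocality_iff_regime_univ]
  refine ⟨regimeLocality_mono fun _ _ _ => trivial, regimeLocality_of_cofinal ?_⟩
  intro T lam _ _ _
  exact ⟨max T (T₀ + 1), lam, le_max_left _ _, le_rfl,
    (lt_add_one T₀).trans_le (le_max_right _ _)⟩

/-! ## 4. Typed forms of what the idea contributes (statements only; for the tenure planner) -/

/-- Level-`u` KINETIC TIME of the TRUE flow over the window `[0, T']` (peculiar velocities
relative to the drift `u₀`): `K_u(z) = ∫₀^{T'} Σ_j ‖v_j(t) − u₀‖² · 1{u ≤ ‖v_j(t) − u₀‖} dt`.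
Dominates the level-`u` fast LENGTH (`L_u ≤ K_u / u`), the quantity the card's kinematic
dichotomy (`Ideator1.relay_span`) charges bad-at-range-`R` particles to, at the `R`-dependent
level `u = Rℓ/(8 Tℓ) = R/8T`. -/
def kineticTimeAbove (u₀ : V3) (u T' : ℝ) {σ : ℝ} {N : ℕ} (Φ : Flow σ N)
    (z : Config (N + 1) (Fin 3) T3) : ℝ :=
  ∫ t in (0 : ℝ)..T', ∑ j : Fin (N + 1),
    Set.indicator {v : V3 | u ≤ ‖v - u₀‖} (fun v => ‖v - u₀‖ ^ 2) ((Φ.flow t z j).2)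

/-- THE IDEA'S CENTRAL PROVABLE STUB, typed (card Lever (F), "FastLengthChernoff"): JENSEN IN
TIME under the flow-invariant `G_N` turns the exponential moment of the level-`u` kinetic time
into an equal-time Maxwellian PRODUCT: for `0 ≤ κ`, `κ T' < 1/(2θ)`,
`∫ exp(κ K_u) dG_N ≤ (1 + ∫_{‖w‖ ≥ u} (e^{κ T' ‖w‖²} − 1) M_{1,θ,0}(w) dw)^{N+1}`
— a per-particle pressure Gaussian in `u`. Proof plan (M): Jensen for `exp` over
`t ∈ [0, T']`, Tonelli (joint measurability on the good set,
`HardSphereFlow.measurable_piecewise_flow`), invariance of `G_N` (`HomogeneousInvariance`, 9621),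
then the velocity marginal of `G_N` is the i.i.d. Maxwellian product (positions integrate out of
`canonicalDensity … (localGibbsProfile a u₀ θ)`). TRUE-world only: the forecast flows `Ψ` have no
invariant law (panel note B / TRIAGE-r1-2 F2), which is one of the foreign stubs listed in the
line card. -/
def FastKineticPressure : Prop :=
  ∀ (a θ : ℝ) (u₀ : V3), 0 < a → 0 < θ → ∀ σ : ℝ, 0 < σ → σ ≤ 1 / 2 →
    ∀ (N : ℕ) (Φ : Flow σ N) (u T' κ : ℝ), 0 ≤ u → 0 < T' → 0 ≤ κ → κ * T' < 1 / (2 * θ) →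
      ∫⁻ z, ENNReal.ofReal (Real.exp (κ * kineticTimeAbove u₀ u T' Φ z)) ∂(gibbs σ a θ u₀ N Φ)
        ≤ ENNReal.ofReal ((1 + ∫ w : V3, Set.indicator {w : V3 | u ≤ ‖w‖}
              (fun w => Real.exp (κ * T' * ‖w‖ ^ 2) - 1) w * localMaxwellian 1 θ (0 : V3) w)
              ^ (N + 1))

/-- "TIE THE AMPLITUDE TO THE HORIZON" (IdeatorOneNotes rec. 1), typed: the crux restricted to
the idea's static regime. By `staticRegime_of_blastRegime` it is implied by (and does not imply)
the crux; recorded so the tenure planner can see exactly what the idea closes the FAST sector of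
— and that it serves no current consumer (13917 needs `lam · T(δ)³ → ∞`). Not proposed. -/
def InfluenceLocalityTied (c : ℝ) : Prop := RegimeLocality (StaticRegime c)

theorem influenceLocalityTied_of_influenceLocality (c : ℝ) (h : InfluenceLocality) :
    InfluenceLocalityTied c :=
  regimeLocality_mono (fun _ _ _ => trivial) (influenceLocality_iff_regime_univ.1 h)

/-- WARNING for the restatement: "tied" is weaker than the crux only because the constant `c`
is fixed BEFORE `σ₀` is produced. If the constant may be chosen after `σ` (i.e. per point
`(T, lam)`), the tied family is the crux again: with `c` quantified inside, every admissible
`(T, lam)` lies in `StaticRegime (lam * T ^ 3)`. -/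
def InfluenceLocalityTiedInside : Prop :=
  ∀ (a θ : ℝ) (u₀ : V3), 0 < a → 0 < θ → ∃ σ₀ : ℝ, 0 < σ₀ ∧ ∀ σ : ℝ, 0 < σ → σ < σ₀ →
    ∀ c : ℝ, ∀ (T lam δ : ℝ), 0 < T → 0 < lam → 0 < δ → StaticRegime c T lam → ∃ R : ℝ, 0 < R ∧
    ∃ N₀ : ℕ, ∀ N : ℕ, N₀ ≤ N → ∀ (Φ : Flow σ N) (Ψ : ClusterFlows σ N), Bound a θ u₀ σ T lam δ R N Φ Ψ

theorem influenceLocality_iff_tiedInside : InfluenceLocality ↔ InfluenceLocalityTiedInside := by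
  rw [influenceLocality_iff_regime_univ]
  constructor
  · intro h a θ u₀ ha hθ
    obtain ⟨σ₀, hσ₀, hσ⟩ := h a θ u₀ ha hθ
    exact ⟨σ₀, hσ₀, fun σ hs hs' _ T lam δ hT hlam hδ _ => hσ σ hs hs' T lam δ hT hlam hδ trivial⟩
  · intro h a θ u₀ ha hθ
    obtain ⟨σ₀, hσ₀, hσ⟩ := h a θ u₀ ha hθ
    exact ⟨σ₀, hσ₀, fun σ hs hs' T lam δ hT hlam hδ _ =>
      hσ σ hs hs' (lam * T ^ 3) T lam δ hT hlam hδ le_rfl⟩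

end

end Summit.AtomisticToContinuum.HydrodynamicLimit.Cruxes.InfluenceLocality.JensenStaticPressures
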